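import Literature.NumberTheory.LFunctions.DeBruijnNewmanConstProofs
import Literature.NumberTheory.LFunctions.DobnerLemma4Proofs
import HarnessLib

/-!
# `Λ ≥ 0` in the `sInf` form — discharge of `deBruijnNewmanConst_nonneg` (rh.S28)

Trunk T-ANT (`Literature/NumberTheory/LFunctions`); second companion of `Equivalents.lean`, holding
the discharges of its `rh.S28` corollaries that need the Rodgers–Tao theorem. No definitions.

The named fact `Literature.NumberTheory.LFunctions.deBruijnNewmanConst_nonneg` (`0 ≤ Λ`,
`Λ = deBruijnNewmanConst = sInf {t | H_t has only real zeros}`) is B. Rodgers, T. Tao, *The de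
Bruijn–Newman constant is non-negative*, Forum Math. Pi 8 (2020), e6 = arXiv:1801.05914,
**Theorem 1.1** (p. 3: "One has `Λ ≥ 0`"), i.e. Newman's conjecture. Its `sInf`-free form
`Literature.NumberTheory.LFunctions.rodgers_tao` ("for every `t < 0`, `H_t` has a non-real zero")
is a theorem of the tree, `Literature.NumberTheory.LFunctions.rodgers_tao_holds`
(`DobnerLemma4Proofs.lean`, proved along A. Dobner, *A proof of Newman's conjecture for the
extended Selberg class*, Acta Arith. 201 (2021) = arXiv:2005.05142). The `sInf` form follows by
Mathlib's `Real.sInf_nonneg` (`(∀ x ∈ S, 0 ≤ x) → 0 ≤ sInf S`, valid for every `S ⊆ ℝ`, so that —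
unlike the interim proof preserved in `Equivalents.lean` — not even the nonemptiness input
`hasOnlyRealZeros_deBruijnH_one_half` is needed): if `H_t` has only real zeros then `t ≥ 0`, for
otherwise `rodgers_tao_holds t` refutes it.

## Contents (all proved)

* `Literature.NumberTheory.LFunctions.deBruijnNewmanConst_nonneg_holds` — **the discharge**
  `theorem deBruijnNewmanConst_nonneg_holds : deBruijnNewmanConst_nonneg`.
* `Literature.NumberTheory.LFunctions.riemannHypothesis_iff_deBruijnNewmanConst_eq_zero` — the
  corollary `RH ↔ Λ = 0` announced in the module docstring of `Equivalents.lean` ("if the Riemann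
  hypothesis is true, it is only barely so", Rodgers–Tao §1), unconditional: the tree's
  `riemannHypothesis_iff_deBruijnNewmanConst_eq_zero_of_rodgers_tao` (`DeBruijnNewmanConstProofs.lean`)
  fed `rodgers_tao_holds`.
* `Literature.NumberTheory.LFunctions.deBruijnNewmanConst_mem_Icc` — `Λ ∈ [0, 1/2]`
  (Theorem 1.1 with de Bruijn's bound `deBruijnNewmanConst_le_one_half`).

## Why a separate file

The discharge cannot be appended to `Equivalents.lean` (the Dobner development imports it:
`DobnerNewmanProofs.lean`) nor to `EquivalentsProofs.lean` (imported by `NewmanProofs.lean`, which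
both `DeBruijnNewmanConstProofs.lean` and the Dobner development import). The same statements exist
under the barrier namespace `Literature.Barriers.RiemannHypothesis` (`NewmanConjectureProofs.lean`);
here they are recorded under the fact's own name, as the `<Fact>_holds` convention requires.

## References

* [RodgersTaoFMP2020] B. Rodgers, T. Tao, Forum Math. Pi 8 (2020), e6, §1 (p. 3) and Theorem 1.1.
* [Dobner2021] A. Dobner, Acta Arith. 201 (2021), 29–62, Thm. 2 (the route formalised in
  `Dobner*.lean`).
* N. G. de Bruijn, *The roots of trigonometric integrals*, Duke Math. J. 17 (1950), Thm. 13 (`Λ ≤ 1/2`).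
-/

namespace Literature.NumberTheory.LFunctions

/-- **Discharge of `Literature.NumberTheory.LFunctions.deBruijnNewmanConst_nonneg`: `0 ≤ Λ`**
(Rodgers–Tao 2020, Theorem 1.1: "One has `Λ ≥ 0`"; Newman's conjecture), for
`Λ = sInf {t | H_t has only real zeros}`. Every member `t` of that set satisfies `0 ≤ t`, since for
`t < 0` the tree's theorem `rodgers_tao_holds` (the `sInf`-free form of Theorem 1.1, proved along
Dobner 2021) produces a non-real zero of `H_t`; conclude by `Real.sInf_nonneg`, which needs neither
nonemptiness nor a lower bound of the set. [cite: RodgersTaoFMP2020, Theorem 1.1] -/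
theorem deBruijnNewmanConst_nonneg_holds : deBruijnNewmanConst_nonneg :=
  Real.sInf_nonneg fun t ht ↦ not_lt.1 fun h ↦ rodgers_tao_holds t h ht

/-- **`RH ↔ Λ = 0`**, unconditionally ("if the Riemann hypothesis is true, it is only 'barely so'",
Rodgers–Tao 2020, §1, p. 3, with Theorem 1.1): `RH ↔ Λ ≤ 0` (de Bruijn–Newman,
`riemannHypothesis_iff_deBruijnNewmanConst_nonpos`) and `Λ ≥ 0` (Theorem 1.1). The corollary
announced in the module docstring of `Equivalents.lean`; it is the tree's conditional
`riemannHypothesis_iff_deBruijnNewmanConst_eq_zero_of_rodgers_tao` fed `rodgers_tao_holds`.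
[cite: RodgersTaoFMP2020, §1 (p. 3) and Theorem 1.1] -/
theorem riemannHypothesis_iff_deBruijnNewmanConst_eq_zero :
    RiemannHypothesis ↔ deBruijnNewmanConst = 0 :=
  riemannHypothesis_iff_deBruijnNewmanConst_eq_zero_of_rodgers_tao rodgers_tao_holds

/-- **`0 ≤ Λ ≤ 1/2`**: Theorem 1.1 of Rodgers–Tao 2020 together with de Bruijn's bound `Λ ≤ 1/2`
(de Bruijn 1950, Thm. 13; `deBruijnNewmanConst_le_one_half`), as quoted in Rodgers–Tao 2020, §1,
p. 3 ("there is an absolute constant `−∞ < Λ ≤ 1/2` …"; "One has `Λ ≥ 0`").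
[cite: RodgersTaoFMP2020, §1 (p. 3) and Theorem 1.1] -/
theorem deBruijnNewmanConst_mem_Icc : deBruijnNewmanConst ∈ Set.Icc (0 : ℝ) (1 / 2) :=
  ⟨deBruijnNewmanConst_nonneg_holds, deBruijnNewmanConst_le_one_half⟩

end Literature.NumberTheory.LFunctions
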